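import Mathlib
import HarnessLib
import HarnessLib.Audit
import Summits.ABC.Statement
import Literature.Barriers.ABC.BakerMethodBounds

/-!
Route: RootDecompK

DORMANT since 2026-09-04T10:18:22Z (reconciler: no traction for 5 d (last activity item-evidence-added at 2026-08-30T09:15:49Z); parked, not closed — `ledger route dormant route-ABC-RootDecompK --off` to reactivate) — unstaffed, not closed; items shared with open routes are served there. `ledger route dormant <id> --off` reactivates.

# Route SmoothMemberSplit — abc splits by member smoothness — abc on every smooth-member cell (q(T)
≤ (log c)^κ, all κ) and abc on the all-rough cell beyond a polylog scale of the floor's choosing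
(declared residual)

It suffices to show X = SmoothMemberCellsABC ∧ RoughMembersFloorABC (root OR-node of cell
decomp-abc, lens 4 «structured-vs-generic radical
split», generation 7; no card realised). For an abc triple T = (a,b,c) let P(n) be the largest prime
factor (P(1) = 1, the tree's
Literature.Barriers.ABC.largestPrimeFactor) and q(T) = min(P a, P b, P c) its MEMBER SMOOTHNESS
(Pasten 2024, Thm 1.4(2)): q(T) is small iff some
member is friable. SmoothMemberCellsABC (SMC, structured): for every real κ, abc (∀ε ∃K) on the cell
q(T) ≤ (log c)^κ. RoughMembersFloorABC
(RMF, generic, DECLARED RESIDUAL): for every ε there are κ and K with c < K·rad^(1+ε) whenever EVERY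
member has a prime factor > (log c)^κ.
EXACT: ABC ⟺ SMC ∧ RMF (kernel node_iff in the lens file; closes = for ε take the floor's κ(ε) and
the ladder's constant at that κ).
Lean: `(∀ κ : ℝ, ∀ ε : ℝ, 0 < ε → ∃ K : ℝ, 0 < K ∧ ∀ a b c : ℕ,
Literature.NumberTheory.DiophantineGeometry.IsABCTriple a b c → ((min
(Literature.Barriers.ABC.largestPrimeFactor a) (min (Literature.Barriers.ABC.largestPrimeFactor b)
(Literature.Barriers.ABC.largestPrimeFactor c)) : ℕ) : ℝ) ≤ Real.log (c : ℝ) ^ κ → (c : ℝ) < K *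
((Literature.NumberTheory.DiophantineGeometry.rad a b c : ℕ) : ℝ) ^ (1 + ε)) ∧ (∀ ε : ℝ, 0 < ε → ∃ κ
: ℝ, ∃ K : ℝ, 0 < K ∧ ∀ a b c : ℕ, Literature.NumberTheory.DiophantineGeometry.IsABCTriple a b c →
Real.log (c : ℝ) ^ κ < ((min (Literature.Barriers.ABC.largestPrimeFactor a) (min
(Literature.Barriers.ABC.largestPrimeFactor b) (Literature.Barriers.ABC.largestPrimeFactor c)) : ℕ)
: ℝ) → (c : ℝ) < K * ((Literature.NumberTheory.DiophantineGeometry.rad a b c : ℕ) : ℝ) ^ (1 + ε))`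

## Assembly
Twelve lines of logic (pkg/glue7.lean `closes`, kernel `closes` / `node_iff` in the lens file):
given ε, take κ and K₂ from RMF at ε, then K₁ from
SMC at (κ, ε); K = max K₁ K₂; a triple either has min(P a,P b,P c) ≤ (log c)^κ (SMC) or not (RMF).
Conversely abc implies both pieces by restriction
(smoothMemberCells_of_abc, roughMembersFloor_of_abc), so the node is exact.

Rationale: WHY THIS LINE. Member smoothness q = min P is the one parameter through which the two strongest
unconditional abc engines already talk to each other: linear
forms in logarithms plus Pasten's Shimura-curve bound give log c ≤ q·exp(κ√(log R·log log R))
(Pasten2024 Thm 1.4(2), improving StewartYu2001 Thm 2;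
tree fact Literature.Barriers.ABC.pasten2024_thm_1_4_2, reduced in tree to
evertseGyory_thm_4_2_1_rat and pasten2024_thm_2_5), i.e. SUB-EXPONENTIAL
abc on every bounded cell q ≤ Q₀ and every growing cell q ≤ (log c)^κ₁, κ₁ < 1 (kernel
subexpOnBoundedCells_of_pasten / subexpOnPolylogCells_of_pasten),
while sub-exponential abc for all triples (GiantExponentRegime's SubexpABC) is open: the structured
piece has a decided analogue where the
statement has none. The extremiser census points the same way: 99.4 % of the 20185 known hits (and
all 241 of quality > 1.4) have a (log c)^2-smooth
member and the maximal quality over the all-rough cell falls monotonically with log q/log log c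
(1.63, 1.63, 1.54, 1.45, 1.35, 1.25, 1.16), which is
the floor's quantifier shape ∀ε ∃κ(ε). Imported: friable-integer / S-unit technology member-wise
(EvertseGyory2015 ch. 4–6), Baker–Wüstholz and
Pasten bounds (BakerWustholz2007 §3.7, Pasten2024), Lagarias–Soundararajan/Harper smooth solutions
as the sub-cell P(abc) < (log c)^κ (tree
XYZConjecture). No prior route conditions on min P: A cuts by smooth MASS of abc at a fixed scale,
D/H by top exponent / level, B/G by radical
divisibility, C/E by signature level, F by stiffness; the negatives index has no member-smoothness
statement.

RANKED CRUXES. #2 SmoothMemberCellsABC (crux) — abc ON EVERY SMOOTH-MEMBER CELL — for every real κ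
and every ε > 0 there is K with c < K·rad(abc)^(1+ε) for all abc triples (a,b,c) some member of
which is (log c)^κ-smooth (min(P a, P b, P c) ≤ (log c)^κ). WEAKER than abc (kernel
smoothMemberCells_of_abc; the κ → ∞ limit is not abc: K = K(κ,ε), a countable ladder SMC ↔ ∀ n,
OneSmoothABC n); rungs antitone in κ; bottom rung κ = 0 ⟺ abc on 1 + b = c (kernel
oneSmooth_zero_iff_unitMember, open); DECIDED ANALOGUE: sub-exponential abc (log c ≤ rad^θ, every θ
> 0) on every cell q ≤ Q₀ and q ≤ (log c)^κ₁, κ₁ < 1, from the tree fact pasten2024_thm_1_4_2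
(kernel); cell kernel-infinite (smoothCell_infinite) and carrying 99.4 % of known hits at κ = 2; not
enterable from the rough cell by identity maps (entry needs a fresh smooth value: 1 of 123 all-rough
hits). [difficulty: open-problem] (why it might fail: cannot fail unless abc fails (restriction); as
a target already κ = 0 is abc on c = b+1 (open) and every κ > 0 asks a POLYNOMIAL bound where
Baker–Pasten give exp(κ√(log R loglog R)) — inside BakerMethodBounds, |S| = π((log c)^κ) growing.)
[Pasten2024, StewartYu2001, BakerWustholz2007, EvertseGyory2015, BombieriGubler2006]
#3 RoughMembersFloorABC (crux) — abc ON THE ALL-ROUGH CELL BEYOND A POLYLOG SCALE OF THE FLOOR'S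
CHOOSING — for every ε > 0 there are κ and K with c < K·rad(abc)^(1+ε) for all abc triples every
member of which has a prime factor > (log c)^κ. DECLARED RESIDUAL (abc on the generic cell: density
one among coprime triples, 0.6 % of known hits at κ = 2, none of quality > 1.4). WEAKER formally
(kernel, via AllRoughABC 0); TRANSPORT-LOADED, declared and bounded in kernel: allRough_transport
(the generic piece decides abc on every triple with a rough shadow — 5.8 % of smooth-member hits at
κ = 2 have a quadratic one) and quadraticImages_keep_smooth_member (a triple with two smooth members
— 86 % of hits, 231/241 of quality > 1.4 — has no all-rough quadratic image whatever the fresh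
value); a uniform exit (costume) would be a largest-prime-factor lower bound for fixed forms along
all abc triples at an adversarial scale, beyond Stewart 2013 and false pointwise on the
two-smooth-member population. [difficulty: open-problem] (why it might fail: it is abc on a
density-one cell (abc-in-waiting by population, declared); inside BakerMethodBounds for every
ε-uniform statement; a high-quality all-rough family (q > 1.45 with every member P > (log c)^2)
would break the lens's reading though not the statement.) [Pasten2024, StewartYu2001,
BombieriGubler2006, Stewart2013]

TWO-LAYER PLAN. SmoothMemberCellsABC ⇐ OneSmoothABC-ladder: foreseen split by scale once a rung
closes — UnitMemberABC (κ = 0, abc on c = b+1) → OneSmoothABC 1 →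
SmoothMemberCellsABC is NOT a glued split (the ladder is infinite); the honest layer-2 children are
(i) UnitMemberABC, (ii) the sub-exponential →
polynomial lift on one growing cell (OneSmoothABC κ for a fixed κ > 0), glue = oneSmooth_anti +
smoothMemberCells_iff_nat per rung. Nothing filed now.

KILL CRITERIA. Refutation of SmoothMemberCellsABC or RoughMembersFloorABC refutes abc itself (both
are restrictions) — route closes refuted:<Decl> and the summit
with it. The LINE (not the statements) dies if (a) the census profile inverts on complete tables
(all-rough hits of quality > 1.45 at κ = 2: the split
no longer separates structured extremisers from generic bulk), or (b) a kernel transport RMF ⟹ ABC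
is found (costume; the lock theorem names what it
would take), or (c) a proof of sub-exponential abc for ALL triples lands (SubexpABC): then the
decided analogue no longer distinguishes C from S and the
door is only a population split.

NOT DECOMPOSED YET. The rungs OneSmoothABC κ (one item per κ would exceed the cap; the ladder is
recorded by smoothMemberCells_iff_nat), the bottom rung UnitMemberABC,
the decided sub-exponential rungs (to be landed under Theorems/ as the BC5 witness, not items), and
any split of the residual (no typed handle
beyond the lock's rough-shadow statement).

CHEAPEST FALSIFIER. Run data/member_smoothness_census.py on the complete S16 / vK–M tables
(minutes): if the max quality over the all-rough(κ = 2) cell exceeds 1.45 or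
the kmin-profile stops decreasing, the lens's reading is dead (the statements survive). Done on the
20185-hit union: profile monotone, max 1.3479.

NUMBERS. Reyssat quality floor 1.6299 (Literature.Barriers.ABC.ExplicitABCQualityFloor; the triple 2
+ 3^10·109 = 23^5 has q = 2, in every structured cell).
Pasten 2024 Thm 1.4(2): log c ≤ q·exp(κ√(log R log log R)); Stewart–Yu 2001 Thm 1: log c ≤ κ
R^(1/3)(log R)^3. Census (20185 hits): one-smooth share at
κ = 0/0.5/1/1.5/2/2.5/3 = 0.051/0.205/0.645/0.944/0.994/0.999/1.000; max all-rough quality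
1.6299/1.6260/1.5444/1.4501/1.3479/1.2502/1.1642.

DEFINITION REQUESTS. None (largestPrimeFactor, IsABCTriple, rad exist in the tree; q(T) is inlined).

Workshop record (writer decomp-abc-writer-1-g3, cell decomp-abc, LADDER-abc rung 0, D-0178): this is
root node SmoothMemberSplit of lens lens-4 «structured-vs-generic radical split» generation 7 (NODE
2026-08-30T06:33:17Z HOME/STATUS.md l.393, REQUEST l.394, KIT-ASK l.395, RESULT/DONE l.396; lens
draft file SmoothMemberSplit.lean sha256
86793e0692901cccd358c001d26f37937f18a67152f4bc307cf6293ccf32ed9a, 899 lines, 0 sorry, axioms std;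
BC5 witness file pkg/SmoothMemberSplitWitness.lean sha256
bf797aacc8259ddf22b05db72208976bb4b200d96fb9f3652e4a52f1c0773993 (subexpOnBoundedCells_of_pasten,
subexpOnPolylogCells_of_pasten mod the tree fact pasten2024_thm_1_4_2; S-case def
SubexpOnAllTriples; refuted instance unitMemberInstance_refuted); critic certificate
HOME/critic/K_SubexpRungUnconditional.lean (subexpOnPolylogCells_unconditional from the TREE THEOREM
Summit.ABC.ABC.Theorems.stewartYu2001_thm2_holds — the rung is KERNEL-UNCONDITIONAL); NODE-g7.md
sha256 0a9ccf93648f9cdf…; items children7.json sha256 040606f9743fd99e…; glue7.json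
4b4718041fecb0ac…; BC7 raw bc/probe-raw-g7.txt; instrument data/member_smoothness_census.py on the
20185-hit union (structured cell 99.4 % of hits at κ = 2, all 241 of quality > 1.4; all-rough κ = 2:
123 hits, max quality 1.3479, kmin profile monotone) and census-1 allrough corner RUN 1 (HOME/STATUS
l.409, kit j339055: 8 hits in the corner, all-rough κ = 2 max quality 1.0252, none above 1.03; RUN 2
j339071 informational), adopted as OR-sibling RootDecompK of the root decomposition (eleventh route
file of the cell; siblings RootDecompA–J; DOOR PLACEMENT: member-smoothness currency q(T) = min(P a,
P b, P c); vs A (smooth MASS at power scale) incomparable both ways, vs F (isolated / prime-power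
member) incomparable, vs B/G/D/H/I/J different axes ⇒ DISTINCT door; LINEAGE DECLARED (critic w1): K
restricted to κ = 0 is Harvest's split abc ⟺ ConsecutiveABC ∧ offFamily (EQ10) — door K = the
POLYLOG THICKENING of the EQ10 split, K stays its own door); writer re-check
L4g7/SmoothMemberSplit_check.lean (lens file + Iff.rfl ×2 on the item texts + node_iff / closes /
NEC by name) lean check rc 0 · 0 sorry · std axioms; critic CLEARED decomp-abc-crit-1-g2
2026-08-30T06:51:57Z (HOME/STATUS.md l.416): own lean_check of SmoothMemberSplit.lean and
SmoothMemberSplitWitness.lean rc0 · 0 sorry · std axioms; item texts = node defs verbatim ×2 + glue;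
closes ROOT-typed, exact AND node_iff, both binders used; GUARDS: NEC ×2 ✓, no EQUIV layer ✓,
DISTRIBUTED honest THIN-formal ∧ RESIDUAL (score 0) ✓, R-EMPTY (a) polarity NORMAL (b) CONS ⟸ SMC ⟸
S (c) both cells inhabited ✓, R-FLAT / vF-T_k not costume (P(a^k) = P(a)) ✓, R-LOWMASS loading by
containment declared (bottom rung) benign ✓, R-REENTRY exit smooth → rough only via one-fresh-factor
images, measured ✓, R-KNOWN no ✓, ε-TIE none in SMC, κ(ε) in RMF the benign floor tie ✓; «ε-ladder
in costume» premise FAILS (the ∀κ conjunction is not ≡ S: K = K(κ, ε) non-uniform, no forced entry)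
⇒ ladder piece ADMISSIBLE; W-items (none blocking, answered in this filing): w1 lineage +
CONS-bottom declared (this paragraph + SMC informal), w2 witness — provers land
SmoothMemberSplitWitness.lean WITH the critic's subexpOnPolylogCells_unconditional next to the
Pasten version and re-run the tribunal with --witness …subexpOnPolylogCells_unconditional --s-case
…SubexpOnAllTriples (rung class KERNEL-ANALOGUE, unconditional; door A/I class), w3 RMF informal
tags, w4 SMC informal tags, w5 TREE records the fixed-scale exact nodes K_κ₀ as one-rung forms (no
items); cap: K = 3 items; tally g2 CLEARED 6 / OBJECTION 0; per-piece tags: SmoothMemberCellsABC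
WEAKER-FORMAL · CONS-BOTTOMED · IDEA-NEEDED (poly lift on one growing cell, INSIDE
BakerMethodBounds, declared) · INSTRUMENTABLE = the attacked conjunct; RoughMembersFloorABC DECLARED
RESIDUAL · S-grade by population · TRANSPORT-LOADED declared and kernel-bounded · ∃κ-guarded
(tribunal_fit.residual); pre-birth tribunal pre-check (writer): --quick and --full PROVISIONAL
(t1_kernel clean ×2, RoughMembersFloorABC role = residual, t3k absent ⇒ plan-only until the witness
lands, t1c timeout on SMC's bridged hypotheses — not a fail).

Novelty: Searches (2026-08-30): lit search --hybrid "abc conjecture triples with a smooth member min largest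
prime factor subexponential bound Pasten" (6 docs:
evertse2015 pp 86–88, vojta1987 p 63, bombieri2006 p 415, baker2007 pp 49–52, guy1994, silverman2009
— none splits abc by member friability);
lit search --hybrid "largest prime factor of 2^n-1 Lucas Lehmer numbers Stewart lower bound"
(guy1994 pp 20–22 context; Stewart 2013 not held);
lit search --hybrid "Lagarias Soundararajan smooth solutions to the abc equation xyz conjecture"
(evertse2015 p 318); lit galaxy search "largest prime
factor of 2^n|Lucas numbers|prime factors of abc" --star pdf (8 junk) and "smooth solutions|smooth
abc|friable" --star pdf (8 junk); tree: rg
largestPrimeFactor / pasten2024_thm_1_4_2 (BakerMethodBounds*, AbcStewartYu2001*, XYZConjecture,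
Pasten2024HybridOfShimura).
Nearest prior art found: Pasten2024 Thm 1.4(2) / StewartYu2001 Thm 2 (member smoothness as the
multiplier of a sub-exponential bound, all triples);
Lagarias–Soundararajan xyz / Harper (all members smooth: existence and counting, not abc); route
RootDecompA (smooth MASS of abc at a fixed scale).
Delta: the first decomposition of abc BY member friability at a polylog scale, with the structured
side's sub-exponential analogue decided in kernel
from the tree's Pasten fact and the generic side's transport load measured and bounded by a kernel
theorem.
Claimed grade: new-combination  [refs: Pasten2024, StewartYu2001]

Barriers (technique_class: friable-integers, linear-forms-in-logs, s-units): - technique_class: friable-integers, linear-forms-in-logs, s-units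
- Literature.Barriers.ABC.BakerMethodBounds: it does not evade it — the structured rungs are INSIDE
(ceiling sub-exponential: log c ≤ q·exp(κ√(log R loglog R))); the bet is that on ONE growing
smooth-member cell (an S-unit equation in one unknown unit with |S| = π((log c)^κ)) the dependence
on |S| can be beaten before it can for all triples; the residual is inside for any ε-uniform
statement (declared).
- Literature.Barriers.ABC.EpsilonCannotBeDropped: inside and discharged — the Stewart–Tijdeman /
Bombieri–Gubler 12.4.12 witnesses (a, c P-units) lie in the bounded structured sub-cell, so both
pieces keep the 1+ε form; EpsilonCannotBeDroppedPolylog likewise.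
- Literature.Barriers.ABC.ExplicitABCQualityFloor: n/a (∃K form, no explicit constant); Reyssat's
triple sits in the structured cell (q = 2).
- Literature.Barriers.ABC.IntegersHaveNoDerivation: not in class — no derivation / Wronskian
substitute on ℤ is posited; member friability is a valuation-count datum and the structured rungs
run on S-unit / linear-forms machinery.
- Literature.Barriers.ABC.IUTDisputedClaim: IUT never cited; nothing here depends on it.
- Negatives index: empty of member-smoothness statements at filing (ledger negatives --problem ABC
read in g6/g7: top-exponent and level statements only); the line steers around the refuted
fixed-exponent strengthenings by keeping ∀ε ∃K.

History (route lifecycle, newest last):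
- 2026-08-30T21:35:16Z · RESIDUAL declared: CrowdedMembersFloorABC (stmt-ABC-30330) — summit-strength until shown otherwise: gate10 D-0170 schema migration (BOOKKEEPING): flags the tribunal residual of record of this conjunct-split root-decompos (planner-decomp-abc-writer-1-g23-0)
- 2026-09-04T10:18:22Z · DORMANT — reconciler: no traction for 5 d (last activity item-evidence-added at 2026-08-30T09:15:49Z); parked, not closed — `ledger route dormant route-ABC-RootDecompK -- (operator:999:2955162)

sub-problem: ABC · status: dormant · opened planner-decomp-abc-writer-1-g3-0 2026-08-30T06:52:50Z · rev 2 · ledger route-ABC-RootDecompK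
GENERATED by the gate from the ledger (D-0016/17). Provers cite these decls: `theorem foo : Summit.ABC.ABC.Theses.RootDecompK.<Decl> := …` in Summits/ABC/ABC/Theorems/<Name>.lean.
-/

namespace Summit.ABC.ABC.Theses.RootDecompK

open scoped BigOperators Topology Manifold Classical MeasureTheory ProbabilityTheory Matrix InnerProductSpace ComplexConjugate ContinuousMap
open Filter Set Function TopologicalSpace MeasureTheory

attribute [summit_statement] _root_.ABC

open Literature.Abc

/-- item stmt-ABC-29725 · crux · leaf IDEA-NEEDED · rank 2 · open · by planner
why it might fail: cannot fail unless abc fails (restriction); as a target already κ = 0 is abc on c = b+1 (open) and every κ > 0 asks a POLYNOMIAL bound where Baker–Pasten give exp(κ√(log R loglog R)) — inside BakerMethodBounds, |S| = π((log c)^κ) growing.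
sources: Pasten2024, StewartYu2001, BakerWustholz2007, EvertseGyory2015, BombieriGubler2006
[crux] abc ON EVERY SMOOTH-MEMBER CELL — for every real κ and every ε > 0 there is K with c <
K·rad(abc)^(1+ε) for all abc triples (a,b,c) some member of which is (log c)^κ-smooth (min(P a, P b,
P c) ≤ (log c)^κ). WEAKER than abc (kernel smoothMemberCells_of_abc; the κ → ∞ limit is not abc: K =
K(κ,ε), a countable ladder SMC ↔ ∀ n, OneSmoothABC n); rungs antitone in κ; bottom rung κ = 0 ⟺ abc
on 1 + b = c (kernel oneSmooth_zero_iff_unitMember, open); DECIDED ANALOGUE: sub-exponential abc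
(log c ≤ rad^θ, every θ > 0) on every cell q ≤ Q₀ and q ≤ (log c)^κ₁, κ₁ < 1, from the tree fact
pasten2024_thm_1_4_2 (kernel); cell kernel-infinite (smoothCell_infinite) and carrying 99.4 % of
known hits at κ = 2; not enterable from the rough cell by identity maps (entry needs a fresh smooth
value: 1 of 123 all-rough hits). [difficulty: open-problem] WORKSHOP TAGS (critic g2 CLEARED
HOME/STATUS l.416, W-items w1/w4): WEAKER-FORMAL (S ⟹ SMC by restriction; SMC ⟹ S unknown and NOT by
transport — no dominance from a registered-weaker statement, unlike J's P_H or H's LogUAF);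
CONS-BOTTOMED — the κ = 0 rung OneSmoothABC 0 ⟺ UnitMemberABC IS Harvest's ConsecutiveABC verbatim
(tree consecutiveABC_iff_abc -/
@[route_item "route-ABC-RootDecompK"]
def SmoothMemberCellsABC : Prop :=
  ∀ κ : ℝ, ∀ ε : ℝ, 0 < ε → ∃ K : ℝ, 0 < K ∧ ∀ a b c : ℕ, Literature.NumberTheory.DiophantineGeometry.IsABCTriple a b c → ((min (Literature.Barriers.ABC.largestPrimeFactor a) (min (Literature.Barriers.ABC.largestPrimeFactor b) (Literature.Barriers.ABC.largestPrimeFactor c)) : ℕ) : ℝ) ≤ Real.log (c : ℝ) ^ κ → (c : ℝ) < K * ((Literature.NumberTheory.DiophantineGeometry.rad a b c : ℕ) : ℝ) ^ (1 + ε)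

/-- item stmt-ABC-29726 · crux · rank 3 · SPLIT (gen 1) into LoneLargePrimeCellsABC, CrowdedMembersFloorABC + glue RMFOfLoneCrowded · direct attempts still welcome (low priority) · by planner
why it might fail: it is abc on a density-one cell (abc-in-waiting by population, declared); inside BakerMethodBounds for every ε-uniform statement; a high-quality all-rough family (q > 1.45 with every member P > (log c)^2) would break the lens's reading though not the statement.
sources: Pasten2024, StewartYu2001, BombieriGubler2006, Stewart2013
[crux] abc ON THE ALL-ROUGH CELL BEYOND A POLYLOG SCALE OF THE FLOOR'S CHOOSING — for every ε > 0
there are κ and K with c < K·rad(abc)^(1+ε) for all abc triples every member of which has a prime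
factor > (log c)^κ. DECLARED RESIDUAL (abc on the generic cell: density one among coprime triples,
0.6 % of known hits at κ = 2, none of quality > 1.4). WEAKER formally (kernel, via AllRoughABC 0);
TRANSPORT-LOADED, declared and bounded in kernel: allRough_transport (the generic piece decides abc
on every triple with a rough shadow — 5.8 % of smooth-member hits at κ = 2 have a quadratic one) and
quadraticImages_keep_smooth_member (a triple with two smooth members — 86 % of hits, 231/241 of
quality > 1.4 — has no all-rough quadratic image whatever the fresh value); a uniform exit (costume)
would be a largest-prime-factor lower bound for fixed forms along all abc triples at an adversarial
scale, beyond Stewart 2013 and false pointwise on the two-smooth-member population. [difficulty: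
open-problem] WORKSHOP TAGS (critic g2 CLEARED l.416, w3): DECLARED RESIDUAL · TRANSPORT-LOADED
(decides abc on the shadowed cell: allRough_transport; two-smooth triples have no budget-admissible
all-rough quadr -/
@[route_item "route-ABC-RootDecompK"]
def RoughMembersFloorABC : Prop :=
  ∀ ε : ℝ, 0 < ε → ∃ κ : ℝ, ∃ K : ℝ, 0 < K ∧ ∀ a b c : ℕ, Literature.NumberTheory.DiophantineGeometry.IsABCTriple a b c → Real.log (c : ℝ) ^ κ < ((min (Literature.Barriers.ABC.largestPrimeFactor a) (min (Literature.Barriers.ABC.largestPrimeFactor b) (Literature.Barriers.ABC.largestPrimeFactor c)) : ℕ) : ℝ) → (c : ℝ) < K * ((Literature.NumberTheory.DiophantineGeometry.rad a b c : ℕ) : ℝ) ^ (1 + ε)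

-- parent: RoughMembersFloorABC · child (gen 1)
/--     item stmt-ABC-30329 · crux · leaf IDEA-NEEDED · rank 301 · open
    parent: RoughMembersFloorABC · by planner
    why it might fail: Inside BakerMethodBounds like SMC: a lone member s·p^e with s smooth still leaves one unknown large prime per member; linear forms in logs give log c ≪ rad^θ, not exponent 1+ε; the flat-lone sub-cell is a powerful-excess inequality nobody can prove.
    sources: StewartYu2001, Literature.Barriers.ABC.BakerMethodBounds, lens-4 g8 NODE-g8.md §3–§4, Pasten2024, BombieriGubler2006, corpus:book:bombieri2006-heights-diophantine-geometry p.481 Thm 14.4.16 (Belyi transport, lineage of the tool)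
[crux · piece LONE LADDER «LoneLargePrimeCellsABC» · child 1 of RoughMembersFloorABC
(stmt-ABC-29726) · lens 4 generation 8 LonePrimeSplit · lens rank r3 · currency ω⁺_y(x) = #{p ∣ x :
p > y} at y = (log c)^κ, INLINED as (x.primeFactors.filter (fun p => Real.log c ^ κ < p)).card]
[crux] LONE LADDER: for every κ and ε there is K(κ,ε) with c < K·rad(abc)^{1+ε} for all abc triples
in which SOME member has exactly one prime factor > (log c)^κ (its (log c)^κ-rough part is a single
prime power). ∀κ is load-bearing (an ∃κ lone floor does not glue). Cells at scale (log c)^κ: SMOOTH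
{∃x ω⁺(x)=0} = door K's road 29725 · LONE {∃x ω⁺(x)=1} (some member = y-smooth × ONE large prime
power) · CROWDED {∀x ω⁺(x)≥2}; kernel SMOOTH ∪ LONE = SIMPLE (simpleMember_iff). Ladder bottom κ ≤ 0
= «some member a prime power» (WEAKER-formal, not claimed ≡ S). First-rung candidates (lens
HANDOFF): flat-lone sub-cell «the lone large prime divides its member exactly once» ⟺ a
powerful-excess inequality s/rad(s) ≤ K c^ε·rad(others)^{…} (kinship door A's currency);
prime-member sub-cell via Stewart–Yu p′. [lens tags: WEAKER-formal (ABC ⟹ it, kernel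
loneCells_of_abc) · IDEA-NEEDED · INSTRUMENTABLE (56 % of known hit -/
@[route_item "route-ABC-RootDecompK"]
def LoneLargePrimeCellsABC : Prop :=
  ∀ κ : ℝ, ∀ ε : ℝ, 0 < ε → ∃ K : ℝ, 0 < K ∧ ∀ a b c : ℕ, Literature.NumberTheory.DiophantineGeometry.IsABCTriple a b c → ((a.primeFactors.filter (fun p : ℕ => Real.log (c : ℝ) ^ κ < (p : ℝ))).card = 1 ∨ (b.primeFactors.filter (fun p : ℕ => Real.log (c : ℝ) ^ κ < (p : ℝ))).card = 1 ∨ (c.primeFactors.filter (fun p : ℕ => Real.log (c : ℝ) ^ κ < (p : ℝ))).card = 1) → (c : ℝ) < K * ((Literature.NumberTheory.DiophantineGeometry.rad a b c : ℕ) : ℝ) ^ (1 + ε)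

-- parent: RoughMembersFloorABC · child (gen 1)
/--     item stmt-ABC-30330 · crux · RESIDUAL (gen 0; summit-strength until shown otherwise, D-0170) · leaf INSTRUMENTABLE · rank 302 · open
    parent: RoughMembersFloorABC · by planner
    why it might fail: It is abc on the generic cell: no structure to lever; any proof is a proof of abc for almost all triples by height with a uniform constant — open; hit-free in all tables (0 of 2,060,037 rows at κ=2) so also unfalsifiable by current data.
    sources: Literature.Barriers.ABC.BakerMethodBounds, lens-4 g8 NODE-g8.md §2–§4, census ANSWERS-g7.md §D (561d60e6), Pasten2024, StewartYu2001, BombieriGubler2006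
[crux · piece CROWDED FLOOR «CrowdedMembersFloorABC» · child 2 of RoughMembersFloorABC
(stmt-ABC-29726) · lens 4 generation 8 LonePrimeSplit · lens rank r4 · DECLARED RESIDUAL of door K
(replaces RoughMembersFloorABC 29726 in the residual slot: RMF ⟹ CMF kernel
crowdedFloor_of_roughMembersFloor, RMF ⟸ LONE ∧ CMF kernel glue; species {29726, this} counted
ONCE)] [crux, DECLARED RESIDUAL] CROWDED FLOOR: for every ε there are κ, K with c < K·rad(abc)^{1+ε}
for all abc triples EVERY member of which has at least two distinct prime factors > (log c)^κ (the
generic-generic cell; rad > (log c)^{6κ} there). ∃κ-guarded like 29726 (the floor chooses its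
polylog scale); R-size on the cell: rad > (log c)^{6κ} (kernel crowded_rad_ge); κ may be raised
(crowded_mono / crowdedFloor_nonneg_scale). CONTENT (disclosed): abc on the generic-generic cell —
no structure to lever, Baker-type input weakest, sieve/counting input (six large primes) strongest;
any proof is abc for the generic triple with a uniform constant; summit-carrying leaf, honest score
0. TEST (stated): hit-free at κ ≥ 1.5 in every census table (0 of 20,185 hits; 0 of 2,060,037
complete-table rows at κ = 2; 10 rows max q 0.368 at κ = 1.5 -/
@[route_item "route-ABC-RootDecompK"]
def CrowdedMembersFloorABC : Prop :=
  ∀ ε : ℝ, 0 < ε → ∃ κ : ℝ, ∃ K : ℝ, 0 < K ∧ ∀ a b c : ℕ, Literature.NumberTheory.DiophantineGeometry.IsABCTriple a b c → 2 ≤ (a.primeFactors.filter (fun p : ℕ => Real.log (c : ℝ) ^ κ < (p : ℝ))).card → 2 ≤ (b.primeFactors.filter (fun p : ℕ => Real.log (c : ℝ) ^ κ < (p : ℝ))).card → 2 ≤ (c.primeFactors.filter (fun p : ℕ => Real.log (c : ℝ) ^ κ < (p : ℝ))).card → (c : ℝ) < K * ((Literature.NumberTheory.DiophantineGeometry.rad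 a b c : ℕ) : ℝ) ^ (1 + ε)

-- parent: RoughMembersFloorABC · glue (gen 1)
/--     item stmt-ABC-30331 · support · rank 303 · open
    parent: RoughMembersFloorABC · GLUE: children ⟹ parent · by planner
LoneLargePrimeCellsABC → CrowdedMembersFloorABC → RoughMembersFloorABC -/
@[route_item "route-ABC-RootDecompK"]
def RMFOfLoneCrowded : Prop :=
  LoneLargePrimeCellsABC → CrowdedMembersFloorABC → RoughMembersFloorABC

/-- item stmt-ABC-30978 · aside · rank 9 · open · by planner
why it might fail: As a statement it is implied by ABC (kernel), so it fails only if abc fails on a lopsided, crowded, Kummer-generic triple; as a ROAD it has none: no engine bites cells that exclude smooth/lone/bounded-shape members, and for κ ≥ 1.5 the hit tables are empty (R-EMPTY hazard inherited from 30330).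
sources: lens-4 g9 OrphanCore.lean + NODE-g9.md (decomp-abc bus), StewartYu2001, Baker2004abc, doi:10.1017/cbo9780511618314 §7.1 (ψ(x,y))
[aside · COMMON RESIDUAL SPECIES of the root doors · tag of record HONEST-NEGATIVE-mod-∀-families
(BE, LopFew)] abc, FORGIVEN as door I (factor ∏_{p ≤ rad^ε} p^{(v_p − ⌈1/ε⌉)⁺}), on the ORPHAN CELL
{c ≤ K·N₅(abc)⁴ ∧ c ≤ K·N₄(abc)⁵ ∧ min(a,b) ≤ c^{1−ε} ∧ every member has ≥ 2 primes > (log c)^κ} (∀K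
∀ε>0 ∃κ ∃C). KERNEL (lens-4 g9 OrphanCore.lean ebdf3ca86b9c…, 0 sorry, std axioms): implied by EACH
live residual — B LopKummerCell5 (28112), G LopKummerCell4 (28097), K CrowdedMembersFloorABC
(30330), I DeepTameForgivenABC (29234) — and by ABC; conversely with the doors' STRUCTURED pieces
(KummerFloor5, KummerFloor4, BalKummerCell5, SmoothMemberCellsABC, LoneLargePrimeCellsABC,
DeepTameHeavyABC) it implies ABC (abc_of_pieces_of_orphanCore): the doors jointly reduce abc to
exactly this. POPULATED: 3 kernel witnesses at K=1, κ=1 (q ≈ 1.187, 1.154 at ε=1/20; q ≈ 1.358 at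
ε=1/60), 99 census hits at ε=1/20 (c up to 10^63); B/G residuals strictly larger (Reyssat, kernel);
A's live residual 27608 disjoint. ≡ S: UNDECIDED (critic l.493: no identity CERTIFIES membership of
its image in the cell — N_sf / N₅ / N₄ of the fresh factor bounded only from below
(transport-blindness); crowdedness of the -/
@[route_item "route-ABC-RootDecompK"]
def OrphanCore : Prop :=
  ∀ K : ℕ, ∀ ε : ℝ, 0 < ε → ∃ κ : ℝ, ∃ C : ℝ, 0 < C ∧ ∀ a b c : ℕ, Literature.NumberTheory.DiophantineGeometry.IsABCTriple a b c → c ≤ K * ((a * b * c).primeFactors.filter (fun p => ¬ 5 ∣ (a * b * c).factorization p)).prod (fun p => p) ^ 4 → c ≤ K * ((a * b * c).primeFactors.filter (fun p => ¬ 4 ∣ (a * b * c).factorization p)).prod (fun p => p) ^ 5 → ((min a b : ℕ) : ℝ) ≤ (c : ℝ) ^ (1 - ε) → 2 ≤ (a.primeFactors.filter (fun p : ℕ => Real.log (c : ℝ) ^ κ < (p : ℝ))).card → 2 ≤ (b.primeFactors.filter (fun p : ℕ => Real.log (c : ℝ) ^ κ < (p : ℝ))).card → 2 ≤ (c.primeFactors.filter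 (fun p : ℕ => Real.log (c : ℝ) ^ κ < (p : ℝ))).card → (c : ℝ) < C * ((∏ p ∈ (a * b * c).primeFactors with p ≤ ⌊((Literature.NumberTheory.DiophantineGeometry.rad a b c : ℕ) : ℝ) ^ ε⌋₊, p ^ ((a * b * c).factorization p - ⌈ε⁻¹⌉₊) : ℕ) : ℝ) * ((Literature.NumberTheory.DiophantineGeometry.rad a b c : ℕ) : ℝ) ^ (1 + ε)

/-- item stmt-ABC-29727 · assembly · rank 1 · open · by planner
sources: Pasten2024
[assembly] SmoothMemberCellsABC → RoughMembersFloorABC → ABC (dichotomy q ≤ (log c)^κ(ε) or not;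
constants max). -/
@[route_item "route-ABC-RootDecompK"]
def Assembly : Prop :=
  SmoothMemberCellsABC → RoughMembersFloorABC → _root_.ABC

/-! D-0027 §2.1 — DECIDING THEOREM (planner-authored via `route open/edit --closes-file`; by planner-decomp-abc-writer-1-g3-0 2026-08-30T06:52:50Z):
its hypotheses are this route's items and its conclusion the sub-problem Statement (glue_lint), and it elaborates with this file. -/

@[closes "route-ABC-RootDecompK"] theorem closes (h₁ : SmoothMemberCellsABC) (h₂ : RoughMembersFloorABC) : _root_.ABC := by
  refine _root_.ABC_iff.mpr fun ε hε => ?_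
  obtain ⟨κ, K₂, hK₂, hR⟩ := h₂ ε hε
  obtain ⟨K₁, hK₁, hS⟩ := h₁ κ ε hε
  refine ⟨max K₁ K₂, lt_max_of_lt_left hK₁, fun a b c ht => ?_⟩
  have hR0 : (0 : ℝ) ≤
      ((Literature.NumberTheory.DiophantineGeometry.rad a b c : ℕ) : ℝ) ^ (1 + ε) := by positivity
  rcases le_or_gt
      (((min (Literature.Barriers.ABC.largestPrimeFactor a)
          (min (Literature.Barriers.ABC.largestPrimeFactor b)
            (Literature.Barriers.ABC.largestPrimeFactor c)) : ℕ) : ℝ))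
      (Real.log (c : ℝ) ^ κ) with hle | hlt
  · exact (hS a b c ht hle).trans_le (mul_le_mul_of_nonneg_right (le_max_left _ _) hR0)
  · exact (hR a b c ht hlt).trans_le (mul_le_mul_of_nonneg_right (le_max_right _ _) hR0)

end Summit.ABC.ABC.Theses.RootDecompK
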